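import Summits.QuantumAdvantage.QuantumAdvantage.Theorems.CharDialCountDialA
import HarnessLib

/-!
# CharDial ▸ CountDial, part G — `SmallOrbitBlocks` in the kernel, I: free classes and anchors, the anchors-fixed permutation family, placements read off the orbit,
# the orbit inequality `(#F)! ≤ (m/D)^{#F} · #orbit`

Part G of «CountDial» (NODE-g24.md §4′): the ORBIT-ENTROPY proof of the permutation-group piece.  For a threshold `D`, a class
(of the exchangeability relation `Sw f`, tree `TransferDial.cls`/`lab`) is FREE if it has `≥ 2` and `≤ m/D` elements (`FreePt`); its label is
its ANCHOR (`anch`), its other points are the free non-anchor points `F` (`nonAnch`; `#E ≤ 2·#F`, `card_freeSet_le`).  The family `𝔉` of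
permutations of `Fin m` supported on `F` (`famF`, `#𝔉 = (#F)!`) moves `f` inside its orbit (`permF`, `orbitS` of part A); exchangeability
transports (★ `sw_permF`: `x ~ y` for `f ∘ σ` iff `σ⁻¹x ~ σ⁻¹y` for `f`), so since anchors are fixed the permute `f ∘ σ` DETERMINES the
placement `a ↦ σ(cls a ∖ a)` (★ `readP_permF`); a fibre of the placement map has `≤ ∏_{i ∈ F} (#cls i − 1)` members (★ `card_fibre_le`,
injection into a `piFinset`), whence ★ `factorial_le_orbit : (#F)! ≤ (m/D)^{#F} · #orbitS f`.  Part H turns this into `SmallOrbitBlocks`.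

Kernel standard: no placeholders; axioms [propext, Classical.choice, Quot.sound] only (guards at the end); closed computations by kernel `decide`.
-/

set_option autoImplicit false
set_option linter.dupNamespace false

namespace Summit.QuantumAdvantage.QuantumAdvantage.Theorems.CountDial

open Classical
open Finset
open Summit.QuantumAdvantage.AdviceFreeQNC0
open Literature.Computability.MetaComplexity Literature.Computability.MetaComplexity.Smolensky
open Summit.QuantumAdvantage.QuantumAdvantage.Theorems.TransferDial

/-! ## `SmallOrbitBlocks` in the kernel, I: anchors, the permutation family, placements, the orbit inequality -/

section SOBKernel
variable {m : ℕ}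

/-- A coordinate lies in a FREE class for threshold `D`: its class has `≥ 2` and `≤ m / D` elements. -/
def FreePt (f : (Fin m → Bool) → Bool) (D : ℕ) (i : Fin m) : Prop := 2 ≤ (cls f i).card ∧ D * (cls f i).card ≤ m

/-- Freeness is a class property. -/
theorem freePt_of_sw (f : (Fin m → Bool) → Bool) (D : ℕ) {i j : Fin m} (h : Sw f i j) (hi : FreePt f D i) : FreePt f D j := by
  unfold FreePt at hi ⊢
  rwa [← cls_eq_of_sw f h]

/-- The label (least element) of a class is exchangeable with every member. -/
theorem sw_lab (f : (Fin m → Bool) → Bool) (i : Fin m) : Sw f i (lab f i) := (mem_cls f i _).1 (lab_mem f i)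

/-- The label of a label is itself. -/
theorem lab_lab (f : (Fin m → Bool) → Bool) (i : Fin m) : lab f (lab f i) = lab f i := (lab_eq_of_sw f (sw_lab f i)).symm

/-- The class of the label is the class. -/
theorem cls_lab (f : (Fin m → Bool) → Bool) (i : Fin m) : cls f (lab f i) = cls f i := (cls_eq_of_sw f (sw_lab f i)).symm

/-- Coordinates with the same label are exchangeable. -/
theorem sw_of_lab_eq (f : (Fin m → Bool) → Bool) {i j : Fin m} (h : lab f i = lab f j) : Sw f i j := by
  have h1 := sw_lab f i
  rw [h] at h1
  exact sw_trans f h1 (sw_symm f (sw_lab f j))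

/-- The free points (the exceptional set `E`). -/
noncomputable def freeSet (f : (Fin m → Bool) → Bool) (D : ℕ) : Finset (Fin m) := univ.filter fun i => FreePt f D i

/-- The free ANCHORS: labels of free classes. -/
noncomputable def anch (f : (Fin m → Bool) → Bool) (D : ℕ) : Finset (Fin m) := univ.filter fun a => FreePt f D a ∧ lab f a = a

/-- The free NON-ANCHOR points `F` (these are permuted). -/
noncomputable def nonAnch (f : (Fin m → Bool) → Bool) (D : ℕ) : Finset (Fin m) := univ.filter fun i => FreePt f D i ∧ lab f i ≠ i

/-- Membership in `freeSet`. -/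
theorem mem_freeSet (f : (Fin m → Bool) → Bool) (D : ℕ) (i : Fin m) : i ∈ freeSet f D ↔ FreePt f D i := by simp [freeSet]

/-- Membership in `anch`. -/
theorem mem_anch (f : (Fin m → Bool) → Bool) (D : ℕ) (a : Fin m) : a ∈ anch f D ↔ FreePt f D a ∧ lab f a = a := by simp [anch]

/-- Membership in `nonAnch`. -/
theorem mem_nonAnch (f : (Fin m → Bool) → Bool) (D : ℕ) (i : Fin m) : i ∈ nonAnch f D ↔ FreePt f D i ∧ lab f i ≠ i := by
  simp [nonAnch]

/-- The label of a free point is a free anchor. -/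
theorem lab_mem_anch (f : (Fin m → Bool) → Bool) (D : ℕ) {i : Fin m} (hi : FreePt f D i) : lab f i ∈ anch f D :=
  (mem_anch f D _).2 ⟨freePt_of_sw f D (sw_lab f i) hi, lab_lab f i⟩

/-- Anchors are not in `F`. -/
theorem not_mem_nonAnch_of_mem_anch (f : (Fin m → Bool) → Bool) (D : ℕ) {a : Fin m} (ha : a ∈ anch f D) : a ∉ nonAnch f D := by
  rw [mem_anch] at ha
  rw [mem_nonAnch]
  exact fun h => h.2 ha.2

/-- `#E = #F + #anchors`. -/
theorem card_freeSet (f : (Fin m → Bool) → Bool) (D : ℕ) : (freeSet f D).card = (nonAnch f D).card + (anch f D).card := by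
  have hu : freeSet f D = nonAnch f D ∪ anch f D := by
    ext i
    simp only [mem_freeSet, mem_union, mem_nonAnch, mem_anch]
    by_cases h : lab f i = i
    · simp [h]
    · simp [h]
  have hd : Disjoint (nonAnch f D) (anch f D) := by
    rw [Finset.disjoint_left]
    intro i hi ha
    exact not_mem_nonAnch_of_mem_anch f D ha hi
  rw [hu, card_union_of_disjoint hd]

/-- There are at most as many free anchors as free non-anchor points (each free class has `≥ 2` elements). -/
theorem card_anch_le (f : (Fin m → Bool) → Bool) (D : ℕ) : (anch f D).card ≤ (nonAnch f D).card := by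
  -- send an anchor to some other point of its class
  let g : Fin m → Fin m := fun a => if h : ((cls f a).erase a).Nonempty then h.choose else a
  have hg : ∀ a ∈ anch f D, g a ∈ (cls f a).erase a := by
    intro a ha
    rw [mem_anch] at ha
    have hne : ((cls f a).erase a).Nonempty := by
      rw [← Finset.card_pos, card_erase_of_mem (self_mem_cls f a)]
      have := ha.1.1
      omega
    simp only [g, dif_pos hne]
    exact hne.choose_spec
  refine Finset.card_le_card_of_injOn g (fun a ha => ?_) (fun a ha a' ha' h => ?_)
  · rw [mem_coe] at ha
    have h1 := hg a ha
    rw [mem_erase, mem_cls] at h1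
    rw [mem_anch] at ha
    rw [mem_coe, mem_nonAnch]
    refine ⟨freePt_of_sw f D h1.2 ha.1, ?_⟩
    rw [← lab_eq_of_sw f h1.2, ha.2]
    exact fun e => h1.1 e.symm
  · rw [mem_coe] at ha ha'
    have h1 := hg a ha
    have h2 := hg a' ha'
    rw [mem_erase, mem_cls] at h1 h2
    rw [h] at h1
    rw [mem_anch] at ha ha'
    have : Sw f a a' := sw_trans f h1.2 (sw_symm f h2.2)
    rw [← ha.2, ← ha'.2]
    exact lab_eq_of_sw f this

/-- `#E ≤ 2 · #F`. -/
theorem card_freeSet_le (f : (Fin m → Bool) → Bool) (D : ℕ) : (freeSet f D).card ≤ 2 * (nonAnch f D).card := by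
  rw [card_freeSet]
  have := card_anch_le f D
  omega

/-! ### The permutation family: permutations of the free non-anchor points -/

/-- Precomposition of a word with `(x y)` and then `σ` = precomposition with `σ` and then `(σ⁻¹ x  σ⁻¹ y)`. -/
theorem comp_swap_perm (σ : Equiv.Perm (Fin m)) (x y : Fin m) (u : Fin m → Bool) :
    (u ∘ σ) ∘ Equiv.swap (σ.symm x) (σ.symm y) = (u ∘ Equiv.swap x y) ∘ σ := by
  funext a
  have h : Equiv.swap (σ.symm x) (σ.symm y) a = σ.symm (Equiv.swap x y (σ a)) := by
    rw [Equiv.swap_apply_apply σ.symm x y, Equiv.Perm.mul_apply, Equiv.Perm.mul_apply]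
    simp
  simp only [Function.comp, h, Equiv.apply_symm_apply]

/-- The coordinate-permute of a cut. -/
def permF (f : (Fin m → Bool) → Bool) (σ : Equiv.Perm (Fin m)) : (Fin m → Bool) → Bool := fun u => f (u ∘ σ)

/-- A permute lies in the orbit. -/
theorem permF_mem_orbitS (f : (Fin m → Bool) → Bool) (σ : Equiv.Perm (Fin m)) : permF f σ ∈ orbitS f := by
  unfold orbitS permF
  exact mem_image_of_mem _ (mem_univ σ)

/-- ★ Exchangeability transported along a permute: `x ~ y` for `f ∘ σ` iff `σ⁻¹ x ~ σ⁻¹ y` for `f`. -/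
theorem sw_permF (f : (Fin m → Bool) → Bool) (σ : Equiv.Perm (Fin m)) (x y : Fin m) :
    Sw (permF f σ) x y ↔ Sw f (σ.symm x) (σ.symm y) := by
  constructor
  · intro h v
    have h1 := h (v ∘ σ.symm)
    simp only [permF] at h1
    rw [← comp_swap_perm] at h1
    have e : (v ∘ ⇑σ.symm) ∘ ⇑σ = v := by funext a; simp
    rwa [e] at h1
  · intro h u
    simp only [permF]
    rw [← comp_swap_perm]
    exact h (u ∘ σ)

/-- The family `𝔉`: permutations of `Fin m` supported on the free non-anchor points. -/
noncomputable def famF (f : (Fin m → Bool) → Bool) (D : ℕ) : Finset (Equiv.Perm (Fin m)) :=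
  (univ : Finset (Equiv.Perm {x // x ∈ nonAnch f D})).image Equiv.Perm.ofSubtype

/-- `#𝔉 = (#F)!`. -/
theorem card_famF (f : (Fin m → Bool) → Bool) (D : ℕ) : (famF f D).card = Nat.factorial (nonAnch f D).card := by
  unfold famF
  rw [card_image_of_injective _ Equiv.Perm.ofSubtype_injective, card_univ, Fintype.card_perm, Fintype.card_coe]

/-- Members of `𝔉` fix every point outside `F`. -/
theorem famF_apply_of_not_mem (f : (Fin m → Bool) → Bool) (D : ℕ) {σ : Equiv.Perm (Fin m)} (hσ : σ ∈ famF f D)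
    {y : Fin m} (hy : y ∉ nonAnch f D) : σ y = y := by
  unfold famF at hσ
  obtain ⟨τ, -, rfl⟩ := mem_image.1 hσ
  exact Equiv.Perm.ofSubtype_apply_of_not_mem τ hy

/-- Members of `𝔉` fix every point outside `F` (inverse form). -/
theorem famF_symm_apply_of_not_mem (f : (Fin m → Bool) → Bool) (D : ℕ) {σ : Equiv.Perm (Fin m)} (hσ : σ ∈ famF f D)
    {y : Fin m} (hy : y ∉ nonAnch f D) : σ.symm y = y := by
  have h := famF_apply_of_not_mem f D hσ hy
  conv_lhs => rw [← h]
  exact σ.symm_apply_apply y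

/-- The PLACEMENT of `σ`: where the non-anchor part of each free class goes (indexed by anchors). -/
noncomputable def place (f : (Fin m → Bool) → Bool) (D : ℕ) (σ : Equiv.Perm (Fin m)) : Fin m → Finset (Fin m) :=
  fun a => if a ∈ anch f D then ((cls f a).erase a).image σ else ∅

/-- READING a placement off a cut: the exchange partners of each free anchor. -/
noncomputable def readP (f : (Fin m → Bool) → Bool) (D : ℕ) (g : (Fin m → Bool) → Bool) : Fin m → Finset (Fin m) :=
  fun a => if a ∈ anch f D then univ.filter (fun y => y ≠ a ∧ Sw g a y) else ∅

/-- ★ The permute `f ∘ σ` DETERMINES the placement of `σ ∈ 𝔉` (anchors are fixed, so the class of an anchor in `f ∘ σ` is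
`{a} ∪ σ(class ∖ {a})`). -/
theorem readP_permF (f : (Fin m → Bool) → Bool) (D : ℕ) {σ : Equiv.Perm (Fin m)} (hσ : σ ∈ famF f D) :
    readP f D (permF f σ) = place f D σ := by
  funext a
  unfold readP place
  by_cases ha : a ∈ anch f D
  · rw [if_pos ha, if_pos ha]
    have hfix' : σ a = a := famF_apply_of_not_mem f D hσ (not_mem_nonAnch_of_mem_anch f D ha)
    have hfix : σ.symm a = a := famF_symm_apply_of_not_mem f D hσ (not_mem_nonAnch_of_mem_anch f D ha)
    ext y
    simp only [mem_filter, mem_univ, true_and, mem_image, mem_erase, mem_cls]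
    rw [sw_permF, hfix]
    constructor
    · rintro ⟨hy, hs⟩
      refine ⟨σ.symm y, ⟨?_, hs⟩, σ.apply_symm_apply y⟩
      intro e
      apply hy
      calc y = σ (σ.symm y) := (σ.apply_symm_apply y).symm
        _ = σ a := by rw [e]
        _ = a := hfix'
    · rintro ⟨z, ⟨hz, hs⟩, rfl⟩
      refine ⟨?_, by simpa using hs⟩
      intro e
      exact hz (σ.injective (e.trans hfix'.symm))
  · rw [if_neg ha, if_neg ha]

/-! ### Fibres of the placement map and the orbit inequality -/

/-- The placements of `𝔉` are read off the orbit: `# place(𝔉) ≤ # orbitS f`. -/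
theorem card_image_place_le (f : (Fin m → Bool) → Bool) (D : ℕ) :
    ((famF f D).image (place f D)).card ≤ (orbitS f).card := by
  have h1 : (famF f D).image (place f D) = ((famF f D).image (permF f)).image (readP f D) := by
    rw [image_image]
    refine image_congr (fun σ hσ => ?_)
    rw [mem_coe] at hσ
    simp only [Function.comp]
    exact (readP_permF f D hσ).symm
  rw [h1]
  refine le_trans card_image_le (card_le_card (fun g hg => ?_))
  obtain ⟨σ, -, rfl⟩ := mem_image.1 hg
  exact permF_mem_orbitS f σ

/-- The per-point fibre bound: `#cls − 1` on `F`, `1` elsewhere. -/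
noncomputable def bnd (f : (Fin m → Bool) → Bool) (D : ℕ) (i : Fin m) : ℕ :=
  if i ∈ nonAnch f D then (cls f i).card - 1 else 1

/-- ★ FIBRE BOUND: the members of `𝔉` with a given placement number `≤ ∏ (#cls i − 1)` over `i ∈ F`
(such a `σ` sends each `i ∈ F` into the placed image of its own class and fixes the rest). -/
theorem card_fibre_le (f : (Fin m → Bool) → Bool) (D : ℕ) {P : Fin m → Finset (Fin m)}
    (hP : P ∈ (famF f D).image (place f D)) :
    ((famF f D).filter (fun σ => place f D σ = P)).card ≤ ∏ i, bnd f D i := by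
  obtain ⟨σ₀, -, rfl⟩ := mem_image.1 hP
  let T : Fin m → Finset (Fin m) := fun i => if i ∈ nonAnch f D then place f D σ₀ (lab f i) else {i}
  have hT : ∀ i, (T i).card ≤ bnd f D i := by
    intro i
    by_cases hi : i ∈ nonAnch f D
    · simp only [T, bnd, if_pos hi]
      have hfree : FreePt f D i := ((mem_nonAnch f D i).1 hi).1
      have ha : lab f i ∈ anch f D := lab_mem_anch f D hfree
      simp only [place, if_pos ha]
      refine le_trans card_image_le ?_
      rw [card_erase_of_mem (self_mem_cls f _), cls_lab]
    · simp [T, bnd, if_neg hi]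
  calc ((famF f D).filter (fun σ => place f D σ = place f D σ₀)).card
      ≤ (Fintype.piFinset T).card := by
        refine Finset.card_le_card_of_injOn (fun σ => ⇑σ) (fun σ hσ => ?_) (fun σ _ τ _ h => Equiv.ext (congrFun h))
        rw [mem_coe, mem_filter] at hσ
        rw [mem_coe, Fintype.mem_piFinset]
        intro i
        by_cases hi : i ∈ nonAnch f D
        · simp only [T, if_pos hi]
          have hfree : FreePt f D i := ((mem_nonAnch f D i).1 hi).1
          have ha : lab f i ∈ anch f D := lab_mem_anch f D hfree
          rw [← hσ.2]
          simp only [place, if_pos ha]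
          refine mem_image_of_mem _ ?_
          rw [mem_erase, mem_cls]
          exact ⟨fun e => ((mem_nonAnch f D i).1 hi).2 e.symm, sw_symm f (sw_lab f i)⟩
        · simp only [T, if_neg hi, mem_singleton]
          exact famF_apply_of_not_mem f D hσ.1 hi
    _ = ∏ i, (T i).card := Fintype.card_piFinset T
    _ ≤ ∏ i, bnd f D i := Finset.prod_le_prod (fun i _ => Nat.zero_le _) (fun i _ => hT i)

/-- ★ THE ORBIT INEQUALITY: `(#F)! ≤ (m / D)^{#F} · #orbitS f` — the anchors-fixed permutations of the free non-anchor
points produce `(#F)!/∏(#cls − 1)` distinct placements, each visible in the orbit. -/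
theorem factorial_le_orbit (f : (Fin m → Bool) → Bool) {D : ℕ} (hD : 0 < D) :
    Nat.factorial (nonAnch f D).card ≤ (m / D) ^ (nonAnch f D).card * (orbitS f).card := by
  have h1 : (famF f D).card ≤ (∏ i, bnd f D i) * ((famF f D).image (place f D)).card :=
    Finset.card_le_mul_card_image _ _ (fun P hP => card_fibre_le f D hP)
  have h2 : (∏ i, bnd f D i) ≤ (m / D) ^ (nonAnch f D).card := by
    have hb : ∀ i, bnd f D i ≤ (if i ∈ nonAnch f D then m / D else 1) := by
      intro i
      by_cases hi : i ∈ nonAnch f D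
      · simp only [bnd, if_pos hi]
        have hfree : FreePt f D i := ((mem_nonAnch f D i).1 hi).1
        have : (cls f i).card ≤ m / D := (Nat.le_div_iff_mul_le hD).2 (by rw [mul_comm]; exact hfree.2)
        omega
      · simp [bnd, if_neg hi]
    calc (∏ i, bnd f D i) ≤ ∏ i, (if i ∈ nonAnch f D then m / D else 1) :=
          Finset.prod_le_prod (fun i _ => Nat.zero_le _) (fun i _ => hb i)
      _ = (m / D) ^ (nonAnch f D).card := by
          rw [Fintype.prod_ite_mem, prod_const]
  rw [← card_famF]
  calc (famF f D).card ≤ (∏ i, bnd f D i) * ((famF f D).image (place f D)).card := h1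
    _ ≤ (m / D) ^ (nonAnch f D).card * (orbitS f).card := Nat.mul_le_mul h2 (card_image_place_le f D)

end SOBKernel

/-! ### Axiom guards -/

/-- info: 'Summit.QuantumAdvantage.QuantumAdvantage.Theorems.CountDial.readP_permF' depends on axioms: [propext,
 choice,
 Quot.sound] -/
#guard_msgs in #print axioms readP_permF

/-- info: 'Summit.QuantumAdvantage.QuantumAdvantage.Theorems.CountDial.card_fibre_le' depends on axioms: [propext,
 choice,
 Quot.sound] -/
#guard_msgs in #print axioms card_fibre_le

/-- info: 'Summit.QuantumAdvantage.QuantumAdvantage.Theorems.CountDial.factorial_le_orbit' depends on axioms: [propext,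
 choice,
 Quot.sound] -/
#guard_msgs in #print axioms factorial_le_orbit

end Summit.QuantumAdvantage.QuantumAdvantage.Theorems.CountDial
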